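import Mathlib
import Summits.KontsevichZagierPeriods.KontsevichZagierPeriods.Theses.InverseLandau
import Summits.KontsevichZagierPeriods.KontsevichZagierPeriods.Theorems.InverseLandauTateFamilyKernelStubFaceRemaindersVanish
import Summits.KontsevichZagierPeriods.KontsevichZagierPeriods.Theorems.InverseLandauTateFamilyKernelStubFaceRationalIdentity
import Summits.KontsevichZagierPeriods.KontsevichZagierPeriods.Theorems.InverseLandauTateFamilyKernelStubHermiteFaceMv
import Summits.KontsevichZagierPeriods.KontsevichZagierPeriods.Theorems.InverseLandauTateFamilyKernelStubFaceSeriesVanishing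

/-!
# Crux `TateFamilyKernel` (stmt-KontsevichZagierPeriods-9130), line `Sketch` — `stub_qhFacesExact` (wave 15 assembly, lead c4)

Both telescoped face families of a quasi-homogeneous pencil with monotone faces and distinct far corners are EXACT:
`stub_faceSeriesVanishing` (vanishing face integrals near the Tate point) ⇒ regrouping into the two grouped face fractions
`N_a/D_a^{k+1} + N_b/D_b^{k+1}` (`k = #W − 1`) ⇒ Hermite reduction of each face (`stub_hermiteFaceMv`) ⇒ the rational identity
of the two `ϖ`-independent densities (`stub_faceRationalIdentity`) ⇒ both remainders vanish (`stub_faceRemaindersVanish`, applied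
in the order dictated by the corner values). Mathlib + landed sibling files; no named fact, no new definition.
-/

noncomputable section

open MeasureTheory Set MvPolynomial
open Literature.NumberTheory.Transcendental

namespace Summit.KontsevichZagierPeriods.InverseLandau.TateFamilyKernel.Descent

/-- **The two telescoped face families are exact** (registered stub `stub_qhFacesExact`, wave 15 assembly) (monotone faces, distinct corner values):
from the vanishing face moments (`stub_qhFaceMoments`) via `stub_faceSeriesVanishing`, Hermite reduction of both faces
(`stub_hermiteFaceMv`, exponent `k = #W − 1`), `stub_faceRationalIdentity` and `stub_faceRemaindersVanish` (applied with the
faces in the order dictated by the corner values `τ_a(0) ≠ τ_b(0)`): both remainders vanish, so the grouped face numerators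
`N_a = Σ_{w,i} e_{w,i}d^i·NAs w i·D_a^{k−i}`, `N_b` satisfy remainder-free Hermite identities, and the face integrals vanish on
some `(0,b₁)`. [folklore] -/
theorem stub_qhFacesExact (a b d : ℕ) (T : MvPolynomial (Fin 2) ℚ) (W : Finset ℕ) (hWne : W.Nonempty)
    (Pw : ℕ → MvPolynomial (Fin 2) ℚ)
    (NAs NBs : ℕ → ℕ → MvPolynomial (Fin (1 + 1)) ℚ)
    (hNA0 : ∀ w, NAs w 0 = C (a : ℚ) * bind₁ ![C 1, X 0] (Pw w))
    (hNAS : ∀ w i, NAs w (i + 1) =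
      X 1 * (pderiv 1 (NAs w i) * (1 - X 1 * bind₁ ![C 1, X 0] T) -
        C ((i : ℚ) + 1) * NAs w i * pderiv 1 (1 - X 1 * bind₁ ![C 1, X 0] T)))
    (hNB0 : ∀ w, NBs w 0 = C (b : ℚ) * bind₁ ![X 0, C 1] (Pw w))
    (hNBS : ∀ w i, NBs w (i + 1) =
      X 1 * (pderiv 1 (NBs w i) * (1 - X 1 * bind₁ ![X 0, C 1] T) -
        C ((i : ℚ) + 1) * NBs w i * pderiv 1 (1 - X 1 * bind₁ ![X 0, C 1] T)))
    (hmomf : ∀ k : ℕ, ∫ s in (0 : ℝ)..1, ∑ w ∈ W,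
      (∏ v ∈ W.erase w, (((v + a + b : ℕ) : ℝ) + (d : ℝ) * k)) *
        ((a : ℝ) * aeval (![1, s] : Fin 2 → ℝ) (Pw w * T ^ k) +
          (b : ℝ) * aeval (![s, 1] : Fin 2 → ℝ) (Pw w * T ^ k)) = 0)
    (τa τb : Polynomial ℚ)
    (hτaT : Polynomial.aeval (X 0 : MvPolynomial (Fin 2) ℚ) τa = bind₁ ![C 1, X 0] T)
    (hτbT : Polynomial.aeval (X 0 : MvPolynomial (Fin 2) ℚ) τb = bind₁ ![X 0, C 1] T)
    (hdega : 0 < τa.natDegree) (hdegb : 0 < τb.natDegree)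
    (hτa : ∀ s ∈ Icc (0 : ℝ) 1, 0 < Polynomial.aeval s τa) (hτb : ∀ s ∈ Icc (0 : ℝ) 1, 0 < Polynomial.aeval s τb)
    (hma : StrictMonoOn (fun s : ℝ => Polynomial.aeval s τa) (Icc 0 1))
    (hmb : StrictMonoOn (fun s : ℝ => Polynomial.aeval s τb) (Icc 0 1))
    (hcorner : Polynomial.aeval (0 : ℝ) τa ≠ Polynomial.aeval (0 : ℝ) τb) :
    ∃ (ca cb : Polynomial ℚ) (Ma Mb : MvPolynomial (Fin 2) ℚ) (b₁ : ℝ), ca ≠ 0 ∧ cb ≠ 0 ∧ 0 < b₁ ∧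
      (Polynomial.aeval (X 1 : MvPolynomial (Fin 2) ℚ) ca *
        (∑ w ∈ W, ∑ i ∈ Finset.range W.card,
          C (((∏ v ∈ W.erase w, (Polynomial.X + Polynomial.C ((v + a + b : ℕ) : ℚ))).coeff i : ℚ) * (d : ℚ) ^ i) * NAs w i * (1 - X 1 * Polynomial.aeval (X 0 : MvPolynomial (Fin 2) ℚ) τa) ^ (W.card - 1 - i)) =
        pderiv 0 Ma * (1 - X 1 * Polynomial.aeval (X 0 : MvPolynomial (Fin 2) ℚ) τa) -
          C ((W.card - 1 : ℕ) : ℚ) * (Ma * pderiv 0 (1 - X 1 * Polynomial.aeval (X 0 : MvPolynomial (Fin 2) ℚ) τa)) ∧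
      Polynomial.aeval (X 1 : MvPolynomial (Fin 2) ℚ) cb *
        (∑ w ∈ W, ∑ i ∈ Finset.range W.card,
          C (((∏ v ∈ W.erase w, (Polynomial.X + Polynomial.C ((v + a + b : ℕ) : ℚ))).coeff i : ℚ) * (d : ℚ) ^ i) * NBs w i * (1 - X 1 * Polynomial.aeval (X 0 : MvPolynomial (Fin 2) ℚ) τb) ^ (W.card - 1 - i)) =
        pderiv 0 Mb * (1 - X 1 * Polynomial.aeval (X 0 : MvPolynomial (Fin 2) ℚ) τb) -
          C ((W.card - 1 : ℕ) : ℚ) * (Mb * pderiv 0 (1 - X 1 * Polynomial.aeval (X 0 : MvPolynomial (Fin 2) ℚ) τb))) ∧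
      (∀ ϖ ∈ Ioo (0 : ℝ) b₁, (∀ s ∈ Icc (0 : ℝ) 1,
          1 - ϖ * Polynomial.aeval s τa ≠ 0 ∧ 1 - ϖ * Polynomial.aeval s τb ≠ 0) ∧
        ∫ s in (0 : ℝ)..1,
          (aeval (![s, ϖ] : Fin 2 → ℝ)
              (∑ w ∈ W, ∑ i ∈ Finset.range W.card,
          C (((∏ v ∈ W.erase w, (Polynomial.X + Polynomial.C ((v + a + b : ℕ) : ℚ))).coeff i : ℚ) * (d : ℚ) ^ i) * NAs w i * (1 - X 1 * Polynomial.aeval (X 0 : MvPolynomial (Fin 2) ℚ) τa) ^ (W.card - 1 - i)) / (1 - ϖ * Polynomial.aeval s τa) ^ (W.card - 1 + 1) +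
            aeval (![s, ϖ] : Fin 2 → ℝ)
              (∑ w ∈ W, ∑ i ∈ Finset.range W.card,
          C (((∏ v ∈ W.erase w, (Polynomial.X + Polynomial.C ((v + a + b : ℕ) : ℚ))).coeff i : ℚ) * (d : ℚ) ^ i) * NBs w i * (1 - X 1 * Polynomial.aeval (X 0 : MvPolynomial (Fin 2) ℚ) τb) ^ (W.card - 1 - i)) / (1 - ϖ * Polynomial.aeval s τb) ^ (W.card - 1 + 1)) = 0) := by
  classical
  set k : ℕ := W.card - 1 with hk
  have hWc : 0 < W.card := Finset.card_pos.2 hWne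
  -- (1) the telescoped face family has vanishing integrals near the Tate point
  obtain ⟨b₀, hb₀, hfs⟩ := stub_faceSeriesVanishing a b d T W Pw NAs NBs hNA0 hNAS hNB0 hNBS hmomf
  -- (2) Hermite reduction of the two grouped faces
  obtain ⟨ca, Ma, RA, hca, hRAdeg, hHa⟩ := stub_hermiteFaceMv τa hdega k
    (∑ w ∈ W, ∑ i ∈ Finset.range W.card,
      C (((∏ v ∈ W.erase w, (Polynomial.X + Polynomial.C ((v + a + b : ℕ) : ℚ))).coeff i : ℚ) * (d : ℚ) ^ i) *
        NAs w i * (1 - X 1 * Polynomial.aeval (X 0 : MvPolynomial (Fin 2) ℚ) τa) ^ (W.card - 1 - i))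
  obtain ⟨cb, Mb, RB, hcb, hRBdeg, hHb⟩ := stub_hermiteFaceMv τb hdegb k
    (∑ w ∈ W, ∑ i ∈ Finset.range W.card,
      C (((∏ v ∈ W.erase w, (Polynomial.X + Polynomial.C ((v + a + b : ℕ) : ℚ))).coeff i : ℚ) * (d : ℚ) ^ i) *
        NBs w i * (1 - X 1 * Polynomial.aeval (X 0 : MvPolynomial (Fin 2) ℚ) τb) ^ (W.card - 1 - i))
  -- (3) real denominators on `(0,b₀)`
  have hD : ∀ ϖ ∈ Ioo (0 : ℝ) b₀, ∀ s ∈ Icc (0 : ℝ) 1,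
      1 - ϖ * Polynomial.aeval s τa ≠ 0 ∧ 1 - ϖ * Polynomial.aeval s τb ≠ 0 := by
    intro ϖ hϖ s hs
    have h := (hfs ϖ hϖ).1 s hs
    rw [← hτaT, ← hτbT, FaceRationalIdentity.aeval_den, FaceRationalIdentity.aeval_den] at h
    exact h
  -- (4) regrouping of the face integrand
  have hregroup : ∀ ϖ ∈ Ioo (0 : ℝ) b₀, ∀ s ∈ Icc (0 : ℝ) 1,
      aeval (![s, ϖ] : Fin 2 → ℝ)
          (∑ w ∈ W, ∑ i ∈ Finset.range W.card,
            C (((∏ v ∈ W.erase w, (Polynomial.X + Polynomial.C ((v + a + b : ℕ) : ℚ))).coeff i : ℚ) * (d : ℚ) ^ i) *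
              NAs w i * (1 - X 1 * Polynomial.aeval (X 0 : MvPolynomial (Fin 2) ℚ) τa) ^ (W.card - 1 - i)) /
          (1 - ϖ * Polynomial.aeval s τa) ^ (k + 1) +
        aeval (![s, ϖ] : Fin 2 → ℝ)
          (∑ w ∈ W, ∑ i ∈ Finset.range W.card,
            C (((∏ v ∈ W.erase w, (Polynomial.X + Polynomial.C ((v + a + b : ℕ) : ℚ))).coeff i : ℚ) * (d : ℚ) ^ i) *
              NBs w i * (1 - X 1 * Polynomial.aeval (X 0 : MvPolynomial (Fin 2) ℚ) τb) ^ (W.card - 1 - i)) /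
          (1 - ϖ * Polynomial.aeval s τb) ^ (k + 1) =
      ∑ w ∈ W, ∑ i ∈ Finset.range W.card,
        (((∏ v ∈ W.erase w, (Polynomial.X + Polynomial.C ((v + a + b : ℕ) : ℚ))).coeff i : ℚ) : ℝ) * (d : ℝ) ^ i *
          (aeval (![s, ϖ] : Fin 2 → ℝ) (NAs w i) /
              aeval (![s, ϖ] : Fin 2 → ℝ) (1 - X 1 * bind₁ ![C 1, X 0] T : MvPolynomial (Fin (1 + 1)) ℚ) ^ (i + 1) +
            aeval (![s, ϖ] : Fin 2 → ℝ) (NBs w i) /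
              aeval (![s, ϖ] : Fin 2 → ℝ) (1 - X 1 * bind₁ ![X 0, C 1] T : MvPolynomial (Fin (1 + 1)) ℚ) ^ (i + 1)) := by
    intro ϖ hϖ s hs
    obtain ⟨hαne, hβne⟩ := hD ϖ hϖ s hs
    rw [← hτaT, ← hτbT, FaceRationalIdentity.aeval_den, FaceRationalIdentity.aeval_den]
    simp only [map_sum, map_mul, map_pow, FaceRationalIdentity.aeval_den,
      MvPolynomial.aeval_C, eq_ratCast, Rat.cast_natCast, Finset.sum_div, ← Finset.sum_add_distrib]
    refine Finset.sum_congr rfl fun w _ => Finset.sum_congr rfl fun i hi => ?_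
    have hik : i ≤ k := by
      have := Finset.mem_range.1 hi
      omega
    have hpa : (1 - ϖ * Polynomial.aeval s τa) ^ (k + 1) =
        (1 - ϖ * Polynomial.aeval s τa) ^ (i + 1) * (1 - ϖ * Polynomial.aeval s τa) ^ (W.card - 1 - i) := by
      rw [← pow_add]; congr 1; omega
    have hpb : (1 - ϖ * Polynomial.aeval s τb) ^ (k + 1) =
        (1 - ϖ * Polynomial.aeval s τb) ^ (i + 1) * (1 - ϖ * Polynomial.aeval s τb) ^ (W.card - 1 - i) := by
      rw [← pow_add]; congr 1; omega
    rw [hpa, hpb, mul_div_mul_right _ _ (pow_ne_zero _ hαne), mul_div_mul_right _ _ (pow_ne_zero _ hβne)]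
    ring
  have hvan : ∀ ϖ ∈ Ioo (0 : ℝ) b₀, ∫ s in (0 : ℝ)..1,
      (aeval (![s, ϖ] : Fin 2 → ℝ)
          (∑ w ∈ W, ∑ i ∈ Finset.range W.card,
            C (((∏ v ∈ W.erase w, (Polynomial.X + Polynomial.C ((v + a + b : ℕ) : ℚ))).coeff i : ℚ) * (d : ℚ) ^ i) *
              NAs w i * (1 - X 1 * Polynomial.aeval (X 0 : MvPolynomial (Fin 2) ℚ) τa) ^ (W.card - 1 - i)) /
          (1 - ϖ * Polynomial.aeval s τa) ^ (k + 1) +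
        aeval (![s, ϖ] : Fin 2 → ℝ)
          (∑ w ∈ W, ∑ i ∈ Finset.range W.card,
            C (((∏ v ∈ W.erase w, (Polynomial.X + Polynomial.C ((v + a + b : ℕ) : ℚ))).coeff i : ℚ) * (d : ℚ) ^ i) *
              NBs w i * (1 - X 1 * Polynomial.aeval (X 0 : MvPolynomial (Fin 2) ℚ) τb) ^ (W.card - 1 - i)) /
          (1 - ϖ * Polynomial.aeval s τb) ^ (k + 1)) = 0 := by
    intro ϖ hϖ
    refine Eq.trans (intervalIntegral.integral_congr (μ := volume) fun s hs => ?_) (hfs ϖ hϖ).2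
    rw [uIcc_of_le zero_le_one] at hs
    exact hregroup ϖ hϖ s hs
  -- (5) the rational identity and the vanishing of both remainders
  obtain ⟨A, B, b', hb', hB, hbd, hid⟩ :=
    stub_faceRationalIdentity τa τb k hτa hτb _ _ Ma Mb RA RB ca cb hHa hHb b₀ hb₀ hD hvan
  have hR : RA = 0 ∧ RB = 0 := by
    rcases lt_or_gt_of_ne hcorner with hlt | hgt
    · exact stub_faceRemaindersVanish τa τb hdega hdegb hτa hτb hma hmb hlt RA RB ca cb hca hcb hRAdeg hRBdeg
        A B b' hb' hB hbd hid
    · have h := stub_faceRemaindersVanish τb τa hdegb hdega hτb hτa hmb hma hgt RB RA cb ca hcb hca hRBdeg hRAdeg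
        A B b' hb' hB (fun s hs => (hbd s hs).symm) (fun ϖ hϖ => by rw [add_comm]; exact hid ϖ hϖ)
      exact ⟨h.2, h.1⟩
  obtain ⟨hRA, hRB⟩ := hR
  rw [hRA, zero_mul, add_zero] at hHa
  rw [hRB, zero_mul, add_zero] at hHb
  exact ⟨ca, cb, Ma, Mb, b₀, hca, hcb, hb₀, ⟨hHa, hHb⟩, fun ϖ hϖ => ⟨hD ϖ hϖ, hvan ϖ hϖ⟩⟩

end Summit.KontsevichZagierPeriods.InverseLandau.TateFamilyKernel.Descent

end
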